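import Literature.Analysis.FluidPDE.HardSphereDynamicsProofs
import Literature.MathematicalPhysics.KineticTheory.HardSphereEuler
import HarnessLib

/-!
# `UGibbsSRBRigidity.TemperedCollisions` (stmt-AtomisticToContinuum-9391), step 3:
# kinematics on hard-sphere orbits — the contact after a collision-free stretch

Helper file (`--supports stmt-AtomisticToContinuum-9391`).  On a hard-sphere orbit on `𝕋³` (the hypothesis
structure `IsHardSphereTrajectory`: right-continuous, free flight between the locally finite collision times, binary
elastic collisions from an incoming left limit), if `(a, t)` is collision-free and a pair `(p, q)` is in contact at
`t`, then the positions at `t` are the free-flight positions from the configuration at `a` and the modulus of the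
normal component of the relative velocity of `(p, q)` at `t` — read on the post-collisional, right-continuous value —
is that of the relative velocity at `a` (`contact_after_free_stretch`: `leftLim_eq_freeFlight`,
`eq_collidePair_leftLim`, `inner_reflectVel_fst_sub_snd`).  Consequently the `(p, q)` term of the item's collision
mark `𝟙_{contact}(γ t) · ε/|⟨n, v_p(t) − v_q(t)⟩|` is dominated by any weight that dominates the marks of contacts
reached by free flight (`ofReal_indicator_mark_le`, the interface with the lifted pair weight of step 2).

References: I. Gallagher, L. Saint-Raymond, B. Texier, *From Newton to Boltzmann* (2013), §4.1;
C. Cercignani, R. Illner, M. Pulvirenti (1994), §4.2.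
-/

noncomputable section

open MeasureTheory Set Filter Topology
open scoped ENNReal InnerProductSpace

namespace Summit.AtomisticToContinuum.HydrodynamicLimit.Theorems

open Literature.Analysis.FluidPDE Literature.MathematicalPhysics.KineticTheory
open Literature.Analysis.FunctionSpaces

/-! ### Kinematics on hard-sphere orbits: the contact after a collision-free stretch -/

/-- **The contact after a collision-free stretch.** On a hard-sphere orbit `γ` on `𝕋³`, if `(a, t)` is
collision-free and the pair `(p, q)` is in contact at time `t ≥ a`, then (i) the positions at `t` are the
free-flight positions from `γ a` — `x_p(t) = x_p(a) + (t − a) v_p(a)`, `x_q(t) = x_q(a) + (t − a) v_q(a)` — and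
(ii) the normal component of the relative velocity at `t` (the right-continuous, post-collisional value) has the
modulus of that of the relative velocity at `a`: `|⟪n, v_p(t) − v_q(t)⟫| = |⟪n, v_p(a) − v_q(a)⟫|` for the
separation `n` at the contact (left limit = free flight, `leftLim_eq_freeFlight`; the value is the elastic
reflection of the left limit, `eq_collidePair_leftLim`, which reverses the normal component,
`inner_reflectVel_fst_sub_snd`; for `t = a` there is nothing to prove). [folklore] -/
theorem contact_after_free_stretch {ε : ℝ} (hε : 0 < ε) {N : ℕ} {γ : ℝ → Config N (Fin 3) T3}
    (hγ : IsHardSphereTrajectory (Torus.geometry (Fin 3)) ε N γ) {a t : ℝ} (hat : a ≤ t)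
    (hfree : ∀ r ∈ Ioo a t, r ∉ collisionTimes (Torus.geometry (Fin 3)) ε γ) {p q : Fin N} (hpq : p ≠ q)
    (hc : γ t ∈ contactSet (Torus.geometry (Fin 3)) N ε p q) :
    ((γ t p).1 = (γ a p).1 + Torus.proj ((t - a) • (γ a p).2) ∧
      (γ t q).1 = (γ a q).1 + Torus.proj ((t - a) • (γ a q).2)) ∧
    |⟪(Torus.geometry (Fin 3)).sepVec (γ t p).1 (γ t q).1, (γ t p).2 - (γ t q).2⟫_ℝ| =
      |⟪(Torus.geometry (Fin 3)).sepVec (γ t p).1 (γ t q).1, (γ a p).2 - (γ a q).2⟫_ℝ| := by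
  rcases hat.eq_or_lt with rfl | hlt
  · simp
  have hG : ∀ x : T3, Continuous ((Torus.geometry (Fin 3)).translate x) := by
    intro x
    have : (Torus.geometry (Fin 3)).translate x = fun v : V3 => x + Torus.proj v := by
      funext v
      exact Torus.geometry_translate x v
    rw [this]
    exact continuous_const.add Torus.continuous_proj
  have hl : Function.leftLim γ t = freeFlight (Torus.geometry (Fin 3)) (t - a) (γ a) :=
    hγ.leftLim_eq_freeFlight hG hlt hfree
  have hpos : ∀ i : Fin N, (γ t i).1 = (γ a i).1 + Torus.proj ((t - a) • (γ a i).2) := by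
    intro i
    rw [← hγ.leftLim_apply_fst hG t i, hl, freeFlight_apply, Torus.geometry_translate]
  have hvel : ∀ i : Fin N, (Function.leftLim γ t i).2 = (γ a i).2 := by
    intro i
    rw [hl, freeFlight_apply]
  refine ⟨⟨hpos p, hpos q⟩, ?_⟩
  obtain ⟨-, heq⟩ := hγ.eq_collidePair_leftLim hpq hc
  set zl := Function.leftLim γ t with hzl
  set n : V3 := (Torus.geometry (Fin 3)).sepVec (γ t p).1 (γ t q).1 with hn
  have hnl : (Torus.geometry (Fin 3)).sepVec (zl p).1 (zl q).1 = n := by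
    rw [hn, hzl, hγ.leftLim_apply_fst hG t p, hγ.leftLim_apply_fst hG t q]
  have hn0 : n ≠ 0 := by
    have hnorm : ‖n‖ = ε := (mem_contactSet.1 hc).2
    intro h0
    rw [h0, norm_zero] at hnorm
    exact hε.ne' hnorm.symm
  have hvp : (γ t p).2 = (reflectVel n ((zl p).2, (zl q).2)).1 := by
    have h : (γ t p).2 = (collidePair (Torus.geometry (Fin 3)) p q zl p).2 :=
      congrArg (fun w : Config N (Fin 3) T3 => (w p).2) heq
    rw [h, collidePair_apply_left hpq, hnl]
  have hvq : (γ t q).2 = (reflectVel n ((zl p).2, (zl q).2)).2 := by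
    have h : (γ t q).2 = (collidePair (Torus.geometry (Fin 3)) p q zl q).2 :=
      congrArg (fun w : Config N (Fin 3) T3 => (w q).2) heq
    rw [h, collidePair_apply_right, hnl]
  rw [hvp, hvq, inner_reflectVel_fst_sub_snd n hn0, abs_neg, hvel p, hvel q]

/-- **The mark of a contact after a collision-free stretch is dominated by the lifted weight.** With `g` a lifted
pair weight for the window length `h` (`exists_liftWeight`: it dominates the mark of every contact reached by
free flight within `[0, h]` from a non-overlapping pair), on a hard-sphere orbit whose stretch `(a, t)` is
collision-free, `t ∈ [a, a + h]`, the `(p, q)` term of the item's collision mark at time `t`,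
`𝟙_{contact (p,q)}(γ t) · ε/|⟨n, v_p(t) − v_q(t)⟩|`, is at most `g (x_p(a) − x_q(a), v_p(a) − v_q(a))`
(`contact_after_free_stretch`; the configuration `γ a` does not overlap). [folklore] -/
theorem ofReal_indicator_mark_le {ε h : ℝ} (hε : 0 < ε) {N : ℕ} {g : T3 → V3 → ℝ≥0∞}
    (hg : ∀ (xi xj : T3) (vi vj : V3) (s : ℝ), ε ≤ Torus.euclidDist xi xj → s ∈ Icc 0 h →
        Torus.euclidDist (xi + Torus.proj (s • vi)) (xj + Torus.proj (s • vj)) = ε →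
        ENNReal.ofReal (ε / |⟪Torus.reprSym ((xi + Torus.proj (s • vi)) - (xj + Torus.proj (s • vj))),
            vi - vj⟫_ℝ|) ≤ g (xi - xj) (vi - vj))
    {γ : ℝ → Config N (Fin 3) T3} (hγ : IsHardSphereTrajectory (Torus.geometry (Fin 3)) ε N γ)
    {a t : ℝ} (hat : t ∈ Icc a (a + h)) (hfree : ∀ r ∈ Ioo a t, r ∉ collisionTimes (Torus.geometry (Fin 3)) ε γ)
    {p q : Fin N} (hpq : p ≠ q) :
    ENNReal.ofReal ((contactSet (Torus.geometry (Fin 3)) N ε p q).indicator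
        (fun y : Config N (Fin 3) T3 =>
          ε / |⟪(Torus.geometry (Fin 3)).sepVec (y p).1 (y q).1, (y p).2 - (y q).2⟫_ℝ|) (γ t)) ≤
      g ((γ a p).1 - (γ a q).1) ((γ a p).2 - (γ a q).2) := by
  by_cases hc : γ t ∈ contactSet (Torus.geometry (Fin 3)) N ε p q
  · rw [indicator_of_mem hc]
    obtain ⟨⟨hxp, hxq⟩, hvel⟩ := contact_after_free_stretch hε hγ hat.1 hfree hpq hc
    have hD : ε ≤ Torus.euclidDist (γ a p).1 (γ a q).1 := by
      have h := (hγ.mem a) p q hpq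
      rwa [Torus.norm_geometry_sepVec] at h
    have hs : t - a ∈ Icc 0 h := ⟨by linarith [hat.1], by linarith [hat.2]⟩
    have hcontact : Torus.euclidDist ((γ a p).1 + Torus.proj ((t - a) • (γ a p).2))
        ((γ a q).1 + Torus.proj ((t - a) • (γ a q).2)) = ε := by
      have h := (mem_contactSet.1 hc).2
      rwa [Torus.norm_geometry_sepVec, hxp, hxq] at h
    have hsep : (Torus.geometry (Fin 3)).sepVec (γ t p).1 (γ t q).1 =
        Torus.reprSym (((γ a p).1 + Torus.proj ((t - a) • (γ a p).2)) -
          ((γ a q).1 + Torus.proj ((t - a) • (γ a q).2))) := by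
      rw [Torus.geometry_sepVec, hxp, hxq]
    rw [hvel, hsep]
    exact hg _ _ _ _ _ hD hs hcontact
  · rw [indicator_of_notMem hc, ENNReal.ofReal_zero]
    exact bot_le


end Summit.AtomisticToContinuum.HydrodynamicLimit.Theorems

end
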